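import Mathlib
import Summits.Ventures.HodgeRepro2.Hypothesis
import Summits.Ventures.HodgeRepro2.Incoherent
import Summits.Ventures.HodgeRepro2.ReflexPos
import Summits.Ventures.HodgeRepro2.T5AutExtension

/-!
# ReflexFieldEq — the reduced reflex field of the Picard datum is `τ′(E)` (Liu Rem. C.2, the
other half; Tier 3 §5/§7, B2)

`Incoherent.lean` (p2 file 2) defines, for a CM-type choice `Φ` and a hermitian matrix `H`, the
reduced signature `reducedSig`, its stabiliser `reducedStabilizer ⊆ Aut(ℂ)` and the reduced
reflex field `reducedReflexField = Fix(reducedStabilizer)`, and states the Prop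
`ReducedReflexFieldEq K Φ H τ : reducedReflexField K Φ H = (Φ.emb τ).fieldRange` — Liu's
Remark C.2 «the reflex field of the datum depends only on the place above the `(n,1)`-place and
equals `τ′(E)`».  `ReflexPos.lean` (file 6) proved the inclusion `τ′(E) ⊆ reducedReflexField`
(`fieldRange_le_reducedReflexField`) and computed the stabiliser (`reducedStabilizer_eq`: for the
Picard signature it is `{σ : σ ∘ τ′ = τ′}`); the other inclusion needs the Galois theory of
`ℂ / τ′(E)` — «left as the Prop» in the annex (LEAN-ANNEX-p2 l. 22).

This file closes it, on the Galois theory of `ℂ/L` for a countable subfield `L ⊂ ℂ` landed by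
p1 (`T5AutExtension.iInf_eqLocusField_eq`: `Fix(Aut(ℂ/L)) = L`, from the extension theorem for
automorphisms of `ℂ` built on transcendence bases):

* `reducedStabilizer_eq_fixing` — for the Picard signature the stabiliser is the pointwise
  fixing group of `τ′(E)`;
* `countable_fieldRange` — `τ′(E)` is countable (`E` a number field);
* **`reducedReflexFieldEq`** — `ReducedReflexFieldEq K Φ H (mk τ₁)` holds: the reduced reflex
  field IS `τ′(E)`, with `τ′ = Φ.emb (mk τ₁)` the embedding of `E` above the `(2,1)`-place;
  `reducedReflexField_eq_fieldRange`, `mem_reducedReflexField_iff` restate it.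
-/

namespace Summit.Ventures.HodgeRepro2.ShimuraData

open NumberField

variable {K : Type*} [Field K] [NumberField K] [NumberField.IsCMField K]

/-- The fixing set of a subfield `L ⊂ ℂ` inside `Aut(ℂ)`. -/
def fixingSet (L : Subfield ℂ) : Set (ℂ ≃+* ℂ) := {σ | ∀ x ∈ L, σ x = x}

omit [NumberField K] [NumberField.IsCMField K] in
/-- `σ ∘ τ′ = τ′` iff `σ` fixes `τ′(E)` pointwise. -/
theorem comp_eq_iff_mem_fixingSet (σ : ℂ ≃+* ℂ) (τ' : K →+* ℂ) :
    (σ : ℂ →+* ℂ).comp τ' = τ' ↔ σ ∈ fixingSet τ'.fieldRange := by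
  constructor
  · intro h x hx
    obtain ⟨k, rfl⟩ := RingHom.mem_fieldRange.mp hx
    exact congrArg (fun f : K →+* ℂ => f k) h
  · intro h
    ext k
    exact h (τ' k) (RingHom.mem_fieldRange.mpr ⟨k, rfl⟩)

/-- For the Picard signature, the stabiliser of the reduced signature is the pointwise fixing
group of `τ′(E)`, `τ′ = Φ.emb (mk τ₁)`. -/
theorem reducedStabilizer_eq_fixing {n : ℕ} {τ₁ : K →+* ℂ}
    {H : Matrix (Fin (n + 1)) (Fin (n + 1)) K} (hH : IsHermitianForm K H)
    (hpos : IsPicardSignaturePos K τ₁ H) (Φ : CMTypeChoice K) :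
    reducedStabilizer K Φ H = fixingSet (Φ.emb (InfinitePlace.mk τ₁)).fieldRange := by
  rw [reducedStabilizer_eq hH hpos Φ]
  ext σ
  exact comp_eq_iff_mem_fixingSet σ _

omit [NumberField.IsCMField K] in
/-- The image of a number field in `ℂ` is countable. -/
theorem countable_fieldRange (τ' : K →+* ℂ) : Countable (τ'.fieldRange) := by
  have hK : Countable K := Finsupp.Countable.of_moduleFinite (R := ℚ) (M := K)
  have : Set.Countable (τ'.fieldRange : Set ℂ) := by
    rw [RingHom.coe_fieldRange]
    exact Set.countable_range τ'
  exact this.to_subtype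

/-- The reduced reflex field is `Fix(fixingSet L)` with `L = τ′(E)`. -/
theorem reducedReflexField_eq_iInf {n : ℕ} {τ₁ : K →+* ℂ}
    {H : Matrix (Fin (n + 1)) (Fin (n + 1)) K} (hH : IsHermitianForm K H)
    (hpos : IsPicardSignaturePos K τ₁ H) (Φ : CMTypeChoice K) :
    reducedReflexField K Φ H =
      ⨅ σ ∈ fixingSet (Φ.emb (InfinitePlace.mk τ₁)).fieldRange,
        (σ : ℂ →+* ℂ).eqLocusField (RingHom.id ℂ) := by
  unfold reducedReflexField
  rw [reducedStabilizer_eq_fixing hH hpos Φ]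

/-- **Liu Rem. C.2, the other half: the reduced reflex field of the Picard datum is `τ′(E)`.**
For the Picard signature positive at `τ₁`, `ReducedReflexFieldEq K Φ H (mk τ₁)` holds:
`reducedReflexField K Φ H = (Φ.emb (mk τ₁)).fieldRange`. The inclusion `⊇` is
`fieldRange_le_reducedReflexField` (ReflexPos.lean); the inclusion `⊆` is the Galois theory of
`ℂ / τ′(E)` (`T5AutExtension.iInf_eqLocusField_eq`, p1). -/
theorem reducedReflexFieldEq {n : ℕ} {τ₁ : K →+* ℂ}
    {H : Matrix (Fin (n + 1)) (Fin (n + 1)) K} (hH : IsHermitianForm K H)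
    (hpos : IsPicardSignaturePos K τ₁ H) (Φ : CMTypeChoice K) :
    ReducedReflexFieldEq K Φ H (InfinitePlace.mk τ₁) := by
  unfold ReducedReflexFieldEq
  rw [reducedReflexField_eq_iInf hH hpos Φ]
  haveI : Countable ((Φ.emb (InfinitePlace.mk τ₁)).fieldRange) :=
    countable_fieldRange (Φ.emb (InfinitePlace.mk τ₁))
  exact T5AutExtension.iInf_eqLocusField_eq (Φ.emb (InfinitePlace.mk τ₁)).fieldRange

/-- The same, for every place `τ` of the form `mk τ₁` with `τ₁` the `(n,1)`-embedding — stated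
with the place as the variable, as `ReducedReflexFieldEq` is. -/
theorem reducedReflexField_eq_fieldRange {n : ℕ} {τ₁ : K →+* ℂ}
    {H : Matrix (Fin (n + 1)) (Fin (n + 1)) K} (hH : IsHermitianForm K H)
    (hpos : IsPicardSignaturePos K τ₁ H) (Φ : CMTypeChoice K) :
    reducedReflexField K Φ H = (Φ.emb (InfinitePlace.mk τ₁)).fieldRange :=
  reducedReflexFieldEq hH hpos Φ

/-- An element of `ℂ` lies in the reduced reflex field iff it is fixed by every automorphism
fixing `τ′(E)` pointwise — and that is iff it lies in `τ′(E)`. -/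
theorem mem_reducedReflexField_iff {n : ℕ} {τ₁ : K →+* ℂ}
    {H : Matrix (Fin (n + 1)) (Fin (n + 1)) K} (hH : IsHermitianForm K H)
    (hpos : IsPicardSignaturePos K τ₁ H) (Φ : CMTypeChoice K) (z : ℂ) :
    z ∈ reducedReflexField K Φ H ↔ z ∈ (Φ.emb (InfinitePlace.mk τ₁)).fieldRange := by
  rw [reducedReflexField_eq_fieldRange hH hpos Φ]

end Summit.Ventures.HodgeRepro2.ShimuraData
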